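import Mathlib.Analysis.Complex.Exponential
import HarnessLib

/-!
# Stub `stub_expQuarter` of line `Sketch` for the crux `ArithStatLadder.IqThreeNotBPP` (stmt-QuantumAdvantage-14864)

The numerical tail bound used in the proof that `BPP` is closed under one-sided randomized
reductions with success probability `≥ 1/q(n)`: the closure machine draws `2 q` fresh seeds, and
all of them miss the good set with probability at most `(1 − 1/q)^{2q}`; here we bound this by
`1/4` for every `q ≥ 1`.

Proof. Mathlib's `Real.one_sub_div_pow_le_exp_neg` (`(1 − t/n)^n ≤ e^{−t}` for `t ≤ n`) with
`n := 2q`, `t := 2` gives `(1 − 1/q)^{2q} ≤ e^{−2}`, and `e^{−2} ≤ 1/4` since `2 ≤ e`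
(`Real.add_one_le_exp 1`) forces `4 ≤ e²`.
-/

set_option linter.dupNamespace false -- D-0017: single-problem summit ⇒ QuantumAdvantage.QuantumAdvantage by design

namespace Summit.QuantumAdvantage.QuantumAdvantage.Theorems.IqThreeNotBPP

/-- `e⁻² ≤ 1/4`. [folklore] -/
theorem exp_neg_two_le_quarter : Real.exp (-2) ≤ 1 / 4 := by
  have h2 : (4 : ℝ) ≤ Real.exp 2 := by
    have h1 : (2 : ℝ) ≤ Real.exp 1 := by linarith [Real.add_one_le_exp (1 : ℝ)]
    rw [show (2 : ℝ) = 1 + 1 by norm_num, Real.exp_add]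
    nlinarith [Real.exp_pos (1 : ℝ)]
  rw [Real.exp_neg, inv_eq_one_div]
  exact one_div_le_one_div_of_le (by norm_num) h2

/-- **Stub `stub_expQuarter`.** For every natural `q ≥ 1`, `(1 − 1/q)^{2q} ≤ 1/4`
(in fact `≤ e^{−2}`). [folklore] -/
theorem stub_expQuarter : ∀ q : ℕ, 1 ≤ q → (1 - 1 / (q : ℝ)) ^ (2 * q) ≤ 1 / 4 := by
  intro q hq
  have hqR : (1 : ℝ) ≤ q := by exact_mod_cast hq
  have hq0 : (q : ℝ) ≠ 0 := by positivity
  have h := Real.one_sub_div_pow_le_exp_neg (n := 2 * q) (t := 2) (by push_cast; linarith)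
  have heq : (1 : ℝ) - 1 / (q : ℝ) = 1 - 2 / ((2 * q : ℕ) : ℝ) := by
    push_cast
    field_simp
  rw [heq]
  exact h.trans exp_neg_two_le_quarter

end Summit.QuantumAdvantage.QuantumAdvantage.Theorems.IqThreeNotBPP
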